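import Literature.Topology.FourManifolds.LinkKhComplex
import Literature.Topology.FourManifolds.LinkKhSaddle
import Literature.Topology.FourManifolds.LinkKhBirthDeath
import Literature.Topology.FourManifolds.LinkKhDichotomy
import Literature.Topology.FourManifolds.KhConnSumMerge
import Literature.Topology.FourManifolds.KhConnSumSplit
import HarnessLib

/-!
# The Khovanov chain map of an oriented saddle on a link Gauss diagram (link tower, T4b, part 2)

Continuation of `LinkKhSaddle` (the state circles of `L.saddle p q`: `IsSaddleMerge`,
`IsSaddleSplit`, `reachable_or_reachable_saddle`, `IsSaddleMerge.surg`, `IsSaddleSplit.surg`),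
using the face glue of `LinkKhDSquared` (`incidence_eq_edgeVal`, `edgeOK_kindAt`,
`sum_ite_state_eq`) and the dichotomy of `LinkKhDichotomy`. Here: the map induced on the
Khovanov complex `(degStates i → R, khovanovD R h t)` of `LinkKhComplex` by the oriented saddle
cobordism from `L` to `L.saddle p q` — Rasmussen (2010), §4.1, eq. (4.1); Khovanov (2000), §6.3;
Jacobsson (2004), §3;
Bar-Natan (2005), §8 — following the architecture of the knot tower's saddles `mergeMap`
(`KhConnSumMerge`) and `splitMap` (`KhConnSumSplit`): entries, linear map, chain map by the
abstract face theorem, filtration.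

## Contents

* `saddleEntry s s'` (for `s : L.EnhancedState`, `s' : (L.saddle p q).EnhancedState`): `0` unless
  `s'.state = s.state =: σ`; then `KhFace.mergeInc` towards the circles of `L.saddle p q` if the
  saddle is a merge in `σ` (multiplication `m` of `A = R[X]/(X² - hX - t)` on the two circles of
  the saddle arcs, all other labels kept), `KhFace.splitInc` from the circles of `L` if it is a
  split (comultiplication `Δ`), `0` if neither; no Koszul sign (`edgeSign_saddle`).
  `saddleEntry_eq_edgeVal`, `homDegree_eq_of_saddleEntry_ne_zero` (degree `0`).
* `saddleMap i : (L.degStates i → R) →ₗ[R] ((L.saddle p q).degStates i → R)`, the matrix of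
  saddle entries (`saddleMap_apply`).
* **Chain map** `khovanovD_comp_saddleMap`:
  `(L.saddle p q).khovanovD R h t i i' ∘ₗ L.saddleMap p q h t i =
    L.saddleMap p q h t i' ∘ₗ L.khovanovD R h t i i'`
  for all `i i'`, under the hypotheses that every flip of `L` (`hms`) and of `L.saddle p q`
  (`hms'`) and the saddle in every state (`hsad`) is a merge or a split — the realisability input,
  exactly as `hms` in `khovanovD_mergeMap` (with one-to-one bifurcations the identity fails, as
  `d² = 0` does for virtual diagrams). ALL chord positions are covered: entrywise
  (`sum_saddleEntry_mul_incidence`) the identity is, for the flip of a chord `i` and the saddle,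
  one two-dimensional face of `KhFaces` with equal signs on both paths; if the over-end of `i` is
  not a head `next p`, `next q` of a saddle arc, the local strands of `i` are the same arcs in both
  diagrams and `KhFace.face_comm` applies verbatim (all sixteen merge/split patterns:
  associativity, coassociativity, `Δ ∘ m`, `m ∘ Δ`, Frobenius, far-commutativity); if it is the
  head of `arcOut p` (resp. `arcOut q`) the first local strand `arcIn (overPos i)` is `arcOut p` in
  `L` but `arcOut q` in `L.saddle p q` (resp. conversely), and the face has a *shared strand*: the
  new abstract theorems `KhFace.face_comm_adj`, `KhFace.face_comm_adj'` (sixteen patterns again,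
  reduced to the five face identities of `KhFaces` after moving strands inside their classes).
  Corollaries `saddleMap_mem_ker`, `saddleMap_mem_range`, and
  `khovanovD_comp_saddleMap_of_isCheckerboard`: for a checkerboard-coloured diagram and a band
  between arcs of the same colour (`LinkKhDichotomy.dichotomy_of_isCheckerboard`,
  `dichotomy_saddle`) only `hsad` remains.
* **Filtration** (Lee's system `h = 0`): `qDegree_ge_of_saddleEntry_ne_zero`
  (`qDegree s - 1 ≤ qDegree s'`: the map is filtered of degree `-1 = χ(saddle)`), through the
  abstract count of labelled classes across a surgery `KhFace.Surg.card_filter_add`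
  (`IsSaddleMerge.labelCount_add`, `IsSaddleSplit.labelCount_add`) and the tables
  `labelDeg_sub_ge_of_mergeCoeff_ne_zero`, `labelDeg_add_sub_ge_of_splitCoeff_ne_zero` of the knot
  tower; at `h = t = 0` the sharp `qDegree_eq_of_saddleEntry_ne_zero` (`= qDegree s - 1`); and the
  `qMin` statement `le_qMin_saddleMap` (`m ≤ qMin x → m - 1 ≤ qMin (S x)`), in the shape of
  `le_qMin_mergeMap` / `le_qMin_splitMap_apply`.
* **Lee theory** (`(ℚ, 0, 1)`): `saddleMap_mem_leeCycles`, `saddleMap_mem_range_leeD`, and the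
  induced map `leeHomologyZeroMap : L.LeeHomologyZero →ₗ[ℚ] (L.saddle p q).LeeHomologyZero`
  (`leeHomologyZeroMap_mk`).
* Bookkeeping of the inverse saddle (`saddle_saddle`): `stateGraph_saddle_saddle`,
  `isSaddleSplit_saddle_iff`, `saddle_merge_or_split_iff`.
* Sanity (`decide`) on the Hopf link `hopfLink` of D2a: the band along the arcs leaving `1` and `2`
  (same colour under `isCheckerboard_hopfLink`: an oriented planar band) is a merge or a split in
  every state (`hopfLink_band_merge_or_split`), hence `khovanovD_comp_saddleMap_hopfLink` holds
  unconditionally; whereas the band along the two parallel clasp arcs (leaving `0` and `2`,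
  opposite colours, not orientable) is neither a merge nor a split in the all-`1` state
  (`hopfLink_clasp_not_merge_or_split`) — the hypothesis `hsad` is genuine.

Not here: the composite of the inverse saddle with the saddle (multiplication by the genus-one
operator `m ∘ Δ`), Rasmussen's Prop. 4.1 for saddles on canonical generators (next layer, with
the Lee states of `LinkLeeStates`), realisability of `hsad` from a planar band.

## References

* J. Rasmussen, *Khovanov homology and the slice genus*, Invent. Math. 182 (2010) 419–447, §4.1,
  eq. (4.1), §4.2 (filtered degree `χ`). [cite: Rasmussen2010, §4 (4.1)]
* M. Khovanov, *A categorification of the Jones polynomial*, Duke Math. J. 101 (2000) 359–426,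
  §6.3 (the saddle), Prop. 8 (faces commute). [cite: Khovanov2000, §6]
* M. Jacobsson, *An invariant of link cobordisms from Khovanov homology*, Algebr. Geom. Topol. 4
  (2004) 1211–1251, §3. [cite: Jacobsson2004, §3]
* D. Bar-Natan, *Khovanov's homology for tangles and cobordisms*, Geom. Topol. 9 (2005), §8.
  [cite: BarNatan2005, §8]
* D. Bar-Natan, *On Khovanov's categorification of the Jones polynomial*, Algebr. Geom. Topol. 2
  (2002), §3.2 (gradings). [cite: BarNatan2002, §3.2]
* O. Viro, *Khovanov homology, its definitions and ramifications*, Fund. Math. 184 (2004), §5.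
  [cite: Viro2004, §5]
-/

open Function Finset

noncomputable section

namespace Literature.Topology.FourManifolds

/-! ## Abstract supplements to `KhFaces`: labelled classes across a surgery -/

namespace KhFace

variable {X : Type*} {R : Type} [CommRing R] {h t : R}

/-- **Counting labelled classes across a surgery.** Let `c'` be obtained from `c` by uniting the
classes of `α`, `β`, and let `la`, `mu` be labellings of the classes of `c`, `c'` agreeing off the
united class. Then for each label `b` the classes of `c` labelled `b` other than those of `α`, `β`
correspond bijectively to the classes of `c'` labelled `b` other than the united one:
`#S(b) + [mu α = b] = #S'(b) + [la α = b] + [la β = b]` (abstract form of the surgery lemma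
`GaussDiagram.card_filter_circle_surgery`). Viro (2004), §5.2; Bar-Natan (2002), §3.2.
[cite: BarNatan2002, §3.2] -/
theorem Surg.card_filter_add {Y Y' : Type*} [Fintype X] [Fintype Y] [Fintype Y'] [DecidableEq Y]
    [DecidableEq Y'] {c : X → Y} {c' : X → Y'} {α β : X} (S : Surg c c' α β)
    (hc : Surjective c) (hc' : Surjective c') {la mu : X → Bool}
    (hla : ∀ x y, c x = c y → la x = la y) (hmu : ∀ x y, c' x = c' y → mu x = mu y)
    (hagree : ∀ x, c' x ≠ c' α → mu x = la x) (b : Bool) :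
    (Finset.univ.filter fun y ↦ ∃ x, c x = y ∧ la x = b).card + (if mu α = b then 1 else 0) =
      (Finset.univ.filter fun y' ↦ ∃ x, c' x = y' ∧ mu x = b).card +
        (if la α = b then 1 else 0) + (if la β = b then 1 else 0) := by
  classical
  set S₁ := (Finset.univ.filter fun y ↦ ∃ x, c x = y ∧ la x = b) with hS₁
  set S₂ := (Finset.univ.filter fun y' ↦ ∃ x, c' x = y' ∧ mu x = b) with hS₂
  have hm₁ : ∀ x, c x ∈ S₁ ↔ la x = b := fun x ↦ by
    simp only [hS₁, Finset.mem_filter, Finset.mem_univ, true_and]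
    exact ⟨fun ⟨a, ha, hb⟩ ↦ (hla x a ha.symm).trans hb, fun hb ↦ ⟨x, rfl, hb⟩⟩
  have hm₂ : ∀ x, c' x ∈ S₂ ↔ mu x = b := fun x ↦ by
    simp only [hS₂, Finset.mem_filter, Finset.mem_univ, true_and]
    exact ⟨fun ⟨a, ha, hb⟩ ↦ (hmu x a ha.symm).trans hb, fun hb ↦ ⟨x, rfl, hb⟩⟩
  -- the induced map on classes
  let φ : Y → Y' := fun y ↦ c' (Classical.choose (hc y))
  have hφ : ∀ x, φ (c x) = c' x := fun x ↦ S.le (Classical.choose_spec (hc (c x)))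
  -- off the classes of `α`, `β` it is a bijection respecting labels
  have hbij : (S₁ \ {c α, c β}).card = (S₂ \ {c' α}).card := by
    refine Finset.card_bij (fun y _ ↦ φ y) ?_ ?_ ?_
    · intro y hy
      obtain ⟨x, rfl⟩ := hc y
      simp only [Finset.mem_sdiff, Finset.mem_insert, Finset.mem_singleton, not_or] at hy ⊢
      obtain ⟨hxS, hxα, hxβ⟩ := hy
      have hx' : c' x ≠ c' α := fun h' ↦ ((S.eq_iff x).1 h').elim hxα hxβ
      rw [hφ, hm₂, hagree x hx']
      exact ⟨(hm₁ x).1 hxS, hx'⟩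
    · intro y₁ hy₁ y₂ hy₂ h12
      obtain ⟨x₁, rfl⟩ := hc y₁
      obtain ⟨x₂, rfl⟩ := hc y₂
      simp only [Finset.mem_sdiff, Finset.mem_insert, Finset.mem_singleton, not_or] at hy₁ hy₂
      rw [hφ, hφ] at h12
      rcases (S.rel x₁ x₂).1 h12 with h' | ⟨h₁', -⟩
      · exact h'
      · exact (h₁'.elim hy₁.2.1 hy₁.2.2).elim
    · intro y' hy'
      obtain ⟨x, rfl⟩ := hc' y'
      simp only [Finset.mem_sdiff, Finset.mem_singleton] at hy'
      obtain ⟨hxS, hxα⟩ := hy'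
      have h₁ : c x ≠ c α := fun h' ↦ hxα (S.le h')
      have h₂ : c x ≠ c β := fun h' ↦ hxα ((S.le h').trans S.eq.symm)
      refine ⟨c x, ?_, hφ x⟩
      simp only [Finset.mem_sdiff, Finset.mem_insert, Finset.mem_singleton, not_or]
      rw [hm₁, ← hagree x hxα]
      exact ⟨(hm₂ x).1 hxS, h₁, h₂⟩
  -- count
  have hd₁ := Finset.card_sdiff_add_card_inter S₁ {c α, c β}
  have hd₂ := Finset.card_sdiff_add_card_inter S₂ {c' α}
  have hi₁ : (S₁ ∩ {c α, c β}).card =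
      (if la α = b then 1 else 0) + (if la β = b then 1 else 0) := by
    rw [Finset.inter_comm, ← Finset.filter_mem_eq_inter, Finset.card_filter,
      Finset.sum_pair S.ne]
    simp only [hm₁]
  have hi₂ : (S₂ ∩ {c' α}).card = if mu α = b then 1 else 0 := by
    rw [Finset.inter_comm, ← Finset.filter_mem_eq_inter, Finset.card_filter,
      Finset.sum_singleton]
    simp only [hm₂]
  omega

/-! ## Abstract supplements to `KhFaces`: faces with a shared strand -/

section Adjacent

variable [Fintype X] [DecidableEq X] {Y₀ Y₁ Y₂ Y₃ : Type*} [DecidableEq Y₀] [DecidableEq Y₁]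
  [DecidableEq Y₂] [DecidableEq Y₃] {c₀₀ : X → Y₀} {c₁₀ : X → Y₁} {c₀₁ : X → Y₂} {c₁₁ : X → Y₃}
  {α β γ : X}

/-- **The face theorem with a shared strand.** The variant of `KhFace.face_comm` in which the two
parallel edges `c₁₀ → c₁₁` and `c₀₀ → c₀₁` of the face are surgeries at the strand pairs
`(β, γ)` and `(α, γ)` respectively, while the other two edges are surgeries at `(α, β)`: this is
the face "saddle at the arcs `α, β` / flip of a chord whose first local strand is the head of the
saddle arc `α`", where the saddle renames that strand to `β`. For each of the sixteen kind patterns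
compatible with the surgery relations the two path sums agree: ten patterns are inconsistent, and
the six consistent ones reduce to `face_MM_MM`, `face_SS_SS`, `face_MS_MS`, `face_SM_SM`,
`face_SM_MS` after renaming strands inside their classes (`Surg.congr`, `mergeInc_congr`,
`splitInc_congr`, `mergeInc_swap`, `splitInc_swap`). Khovanov (2000), Prop. 8, §6;
Bar-Natan (2005), §8. [cite: Khovanov2000, §6] -/
theorem face_comm_adj (k₁ k₂ k₃ k₄ : Kind) (h₁ : EdgeOK k₁ c₀₀ c₁₀ α β)
    (h₂ : EdgeOK k₂ c₁₀ c₁₁ β γ) (h₃ : EdgeOK k₃ c₀₀ c₀₁ α γ) (h₄ : EdgeOK k₄ c₀₁ c₁₁ α β)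
    (la : Lab c₀₀) (nu : Lab c₁₁) :
    ∑ mu : Lab c₁₀, edgeVal R h t k₁ c₀₀ c₁₀ la.1 mu.1 α β *
        edgeVal R h t k₂ c₁₀ c₁₁ mu.1 nu.1 β γ =
      ∑ mu : Lab c₀₁, edgeVal R h t k₃ c₀₀ c₀₁ la.1 mu.1 α γ *
        edgeVal R h t k₄ c₀₁ c₁₁ mu.1 nu.1 α β := by
  cases k₁ <;> cases k₂ <;> cases k₃ <;> cases k₄ <;> simp only [edgeVal, EdgeOK] at h₁ h₂ h₃ h₄ ⊢
  · -- merge–merge / merge–merge: move the strand `β` of the second merge to `α`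
    have hβα : c₁₁ β = c₁₁ α := (h₂.le h₁.eq).symm
    calc _ = ∑ mu : Lab c₁₀, mergeInc R h t c₁₀ la.1 mu.1 α β *
          mergeInc R h t c₁₁ mu.1 nu.1 α γ :=
        Finset.sum_congr rfl fun mu _ ↦ by
          rw [mergeInc_congr (α₁ := β) (β₁ := γ) (α := α) (β := γ) hβα
            (mu.2 β α h₁.eq.symm) rfl (nu.2 β α hβα)]
      _ = _ := face_MM_MM h₁ (h₂.congr h₁.eq rfl) h₃ h₄ la nu
  · exact absurd (h₂.le h₁.eq) h₄.ne
  · exact absurd (h₁.eq.symm.trans (h₁.le h₃.eq)) h₂.ne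
  · exact absurd (h₃.le h₄.eq) h₁.ne
  · exact absurd (h₄.eq.symm.trans (h₄.le h₃.eq)) h₂.ne
  · -- merge–split / merge–split (`Δ ∘ m`): all four surgeries at `(α, β)`
    have hγβ : c₀₀ γ = c₀₀ β := by
      rcases (h₃.eq_iff β).1 h₄.eq.symm with h' | h'
      · exact absurd h'.symm h₁.ne
      · exact h'.symm
    have hγα : c₁₁ γ = c₁₁ α := by
      rcases (h₄.eq_iff γ).1 h₃.eq.symm with h' | h'
      · exact h'
      · exact absurd h'.symm h₂.ne
    calc _ = ∑ mu : Lab c₁₀, mergeInc R h t c₁₀ la.1 mu.1 α β *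
          splitInc R h t c₁₀ mu.1 nu.1 α β :=
        Finset.sum_congr rfl fun mu _ ↦ by
          rw [splitInc_congr (α₁ := β) (β₁ := γ) (α := β) (β := α) rfl rfl rfl (nu.2 γ α hγα),
            splitInc_swap h₁.eq mu nu.1]
      _ = ∑ mu : Lab c₀₁, mergeInc R h t c₀₁ la.1 mu.1 α β *
          splitInc R h t c₀₁ mu.1 nu.1 α β :=
        face_MS_MS h₁ ((h₂.congr rfl hγα.symm).symm) (h₃.congr rfl hγβ.symm) h₄ la nu
      _ = _ := Finset.sum_congr rfl fun mu _ ↦ by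
          rw [mergeInc_congr (α₁ := α) (β₁ := γ) (α := α) (β := β) rfl rfl (la.2 γ β hγβ) rfl]
  · -- merge–split / split–merge (mirror Frobenius): move `β` of the second split to `α`
    calc _ = ∑ mu : Lab c₁₀, mergeInc R h t c₁₀ la.1 mu.1 α β *
          splitInc R h t c₁₀ mu.1 nu.1 α γ :=
        Finset.sum_congr rfl fun mu _ ↦ by
          rw [splitInc_congr (α₁ := β) (β₁ := γ) (α := α) (β := γ) h₁.eq.symm
            (mu.2 β α h₁.eq.symm) (nu.2 β α h₄.eq.symm) rfl]
      _ = _ := (face_SM_MS h₃ h₄ h₁ (h₂.congr h₄.eq rfl) la nu).symm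
  · exact absurd (h₃.le h₄.eq) h₁.ne
  · exact absurd (h₃.le h₁.eq) h₄.ne
  · -- split–merge / merge–split (Frobenius): move `α` of the second merge to `β`
    calc _ = ∑ mu : Lab c₀₁, mergeInc R h t c₀₁ la.1 mu.1 β γ *
          splitInc R h t c₀₁ mu.1 nu.1 α β := face_SM_MS h₁ h₂ (h₃.congr h₁.eq.symm rfl) h₄ la nu
      _ = _ := Finset.sum_congr rfl fun mu _ ↦ by
          rw [mergeInc_congr (α₁ := α) (β₁ := γ) (α := β) (β := γ) h₄.eq
            (la.2 α β h₁.eq) rfl (mu.2 α β h₄.eq)]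
  · -- split–merge / split–merge (genus one): all four surgeries at `(α, β)`
    have hγα : c₁₀ γ = c₁₀ α := by
      rcases (h₁.eq_iff γ).1 h₃.eq.symm with h' | h'
      · exact h'
      · exact absurd h'.symm h₂.ne
    have hβγ : c₀₁ β = c₀₁ γ := by
      rcases (h₃.eq_iff β).1 h₁.eq.symm with h' | h'
      · exact absurd h'.symm h₄.ne
      · exact h'
    calc _ = ∑ mu : Lab c₁₀, splitInc R h t c₀₀ la.1 mu.1 α β *
          mergeInc R h t c₁₁ mu.1 nu.1 α β :=
        Finset.sum_congr rfl fun mu _ ↦ by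
          rw [mergeInc_congr (α₁ := β) (β₁ := γ) (α := β) (β := α) rfl rfl (mu.2 γ α hγα) rfl,
            mergeInc_swap h₄.eq mu.1 nu]
      _ = ∑ mu : Lab c₀₁, splitInc R h t c₀₀ la.1 mu.1 α β *
          mergeInc R h t c₁₁ mu.1 nu.1 α β :=
        face_SM_SM h₁ ((h₂.congr rfl hγα.symm).symm) (h₃.congr rfl hβγ) h₄ la nu
      _ = _ := Finset.sum_congr rfl fun mu _ ↦ by
          rw [splitInc_congr (α₁ := α) (β₁ := γ) (α := α) (β := β) rfl rfl rfl
            (mu.2 γ β hβγ.symm)]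
  · exact absurd (h₄.eq.trans (h₄.le h₂.eq)) h₃.ne
  · exact absurd (h₁.eq.trans (h₁.le h₂.eq)) h₃.ne
  · exact absurd (h₁.eq.trans (h₁.le h₂.eq)) h₃.ne
  · exact absurd (h₂.le h₄.eq) h₁.ne
  · -- split–split / split–split: move `α` of the second split to `β`
    calc _ = ∑ mu : Lab c₀₁, splitInc R h t c₀₀ la.1 mu.1 β γ *
          splitInc R h t c₀₁ mu.1 nu.1 α β := face_SS_SS h₁ h₂ (h₃.congr h₄.eq.symm rfl) h₄ la nu
      _ = _ := Finset.sum_congr rfl fun mu _ ↦ by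
          rw [splitInc_congr (α₁ := α) (β₁ := γ) (α := β) (β := γ) h₁.eq (la.2 α β h₁.eq)
            (mu.2 α β h₄.eq) rfl]

/-- The mirror image of `face_comm_adj`: the parallel edges are at `(α, γ)` and `(β, γ)` (the
flipped chord sits at the head of the saddle arc `β`). [cite: Khovanov2000, §6] -/
theorem face_comm_adj' (k₁ k₂ k₃ k₄ : Kind) (h₁ : EdgeOK k₁ c₀₀ c₁₀ α β)
    (h₂ : EdgeOK k₂ c₁₀ c₁₁ α γ) (h₃ : EdgeOK k₃ c₀₀ c₀₁ β γ) (h₄ : EdgeOK k₄ c₀₁ c₁₁ α β)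
    (la : Lab c₀₀) (nu : Lab c₁₁) :
    ∑ mu : Lab c₁₀, edgeVal R h t k₁ c₀₀ c₁₀ la.1 mu.1 α β *
        edgeVal R h t k₂ c₁₀ c₁₁ mu.1 nu.1 α γ =
      ∑ mu : Lab c₀₁, edgeVal R h t k₃ c₀₀ c₀₁ la.1 mu.1 β γ *
        edgeVal R h t k₄ c₀₁ c₁₁ mu.1 nu.1 α β := by
  -- swap the roles of `α` and `β` in the two saddle edges
  have e₁ : ∀ mu : Lab c₁₀, edgeVal R h t k₁ c₀₀ c₁₀ la.1 mu.1 α β =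
      edgeVal R h t k₁ c₀₀ c₁₀ la.1 mu.1 β α := fun mu ↦ by
    cases k₁
    · exact (mergeInc_swap h₁.eq la.1 mu).symm
    · exact (splitInc_swap h₁.eq la mu.1).symm
  have e₄ : ∀ mu : Lab c₀₁, edgeVal R h t k₄ c₀₁ c₁₁ mu.1 nu.1 α β =
      edgeVal R h t k₄ c₀₁ c₁₁ mu.1 nu.1 β α := fun mu ↦ by
    cases k₄
    · exact (mergeInc_swap h₄.eq mu.1 nu).symm
    · exact (splitInc_swap h₄.eq mu nu.1).symm
  have h₁' : EdgeOK k₁ c₀₀ c₁₀ β α := by cases k₁ <;> exact Surg.symm h₁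
  have h₄' : EdgeOK k₄ c₀₁ c₁₁ β α := by cases k₄ <;> exact Surg.symm h₄
  calc _ = ∑ mu : Lab c₁₀, edgeVal R h t k₁ c₀₀ c₁₀ la.1 mu.1 β α *
        edgeVal R h t k₂ c₁₀ c₁₁ mu.1 nu.1 α γ := Finset.sum_congr rfl fun mu _ ↦ by rw [e₁]
    _ = ∑ mu : Lab c₀₁, edgeVal R h t k₃ c₀₀ c₀₁ la.1 mu.1 β γ *
        edgeVal R h t k₄ c₀₁ c₁₁ mu.1 nu.1 β α := face_comm_adj k₁ k₂ k₃ k₄ h₁' h₂ h₃ h₄' la nu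
    _ = _ := Finset.sum_congr rfl fun mu _ ↦ by rw [e₄]

end Adjacent

end KhFace

namespace LinkGaussDiagram

-- As in `LinkKhSaddle`: `L.saddle p q` shares chords, states and arcs with `L` definitionally;
-- reducibility lets `rw`/`simp` handle statements mixing the two diagrams.
set_option allowUnsafeReducibility true in
attribute [local reducible] LinkGaussDiagram.saddle

variable (L : LinkGaussDiagram) (p q : Fin (2 * L.n))

/-! ## The kind of a saddle and its entries -/

section Entry

/-- The **kind** of the saddle at `(p, q)` in the state `σ`: a merge if `IsSaddleMerge`, a split
otherwise (meaningful when the saddle is a merge or a split in `σ`). Rasmussen (2010), §4.1.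
[cite: Rasmussen2010, §4.1] -/
def saddleKind (σ : L.State) : KhFace.Kind :=
  if L.IsSaddleMerge p q σ then KhFace.Kind.merge else KhFace.Kind.split

variable {L p q} in
/-- A merge-or-split saddle satisfies the surgery relation of its kind between the circle maps of
`L` and `L.saddle p q` at the saddle arcs. [folklore] -/
theorem edgeOK_saddleKind {σ : L.State} (hsad : L.IsSaddleMerge p q σ ∨ L.IsSaddleSplit p q σ) :
    KhFace.EdgeOK (L.saddleKind p q σ) (L.circleOf σ) ((L.saddle p q).circleOf σ) (L.arcOut p)
      (L.arcOut q) := by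
  unfold saddleKind
  by_cases hm : L.IsSaddleMerge p q σ
  · rw [if_pos hm]
    exact hm.surg
  · rw [if_neg hm]
    exact (hsad.resolve_left hm).surg

variable {R : Type} [CommRing R] (h t : R)

/-- **The entries of the saddle map** `S : C(L) → C(L.saddle p q)` on enhanced states
(Rasmussen (2010), §4.1, eq. (4.1); Khovanov (2000), §6.3; Jacobsson (2004), §3): zero unless the
two enhanced states have the same underlying state `σ` (the saddle acts vertexwise on the cube),
and then
* if the saddle is a merge in `σ`: the abstract merge incidence number `KhFace.mergeInc` towards
  the circles of `L.saddle p q` — labels agree off the merged circle, and the label of the merged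
  circle comes with the structure constant `mergeCoeff` of the multiplication of
  `A = R[X]/(X² - hX - t)`;
* if it is a split: the abstract split incidence number `KhFace.splitInc` from the circles of
  `L` — the comultiplication `Δ`;
* if it is neither (one-to-one bifurcation, virtual diagrams only): `0`.
No Koszul sign: the saddle has degree `0` in the cube direction. [cite: Rasmussen2010, §4 (4.1)] -/
def saddleEntry (s : L.EnhancedState) (s' : (L.saddle p q).EnhancedState) : R :=
  if s'.state = s.state then
    if L.IsSaddleMerge p q s.state then
      KhFace.mergeInc R h t ((L.saddle p q).circleOf s.state) s.label s'.label (L.arcOut p)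
        (L.arcOut q)
    else if L.IsSaddleSplit p q s.state then
      KhFace.splitInc R h t (L.circleOf s.state) s.label s'.label (L.arcOut p) (L.arcOut q)
    else 0
  else 0

variable {L p q h t}

/-- Entries of the saddle map vanish off the diagonal of states. [folklore] -/
theorem saddleEntry_of_ne {s : L.EnhancedState} {s' : (L.saddle p q).EnhancedState}
    (hs : s'.state ≠ s.state) : L.saddleEntry p q h t s s' = 0 :=
  if_neg hs

/-- A nonzero entry of the saddle map sits over one state. [folklore] -/
theorem state_eq_of_saddleEntry_ne_zero {s : L.EnhancedState} {s' : (L.saddle p q).EnhancedState}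
    (hs : L.saddleEntry p q h t s s' ≠ 0) : s'.state = s.state := by
  by_contra hne
  exact hs (saddleEntry_of_ne hne)

/-- **Saddle entry = edge value** of the abstract face algebra, for a merge-or-split saddle: the
edge from the circle map of `L` to that of `L.saddle p q` at the saddle arcs, of kind
`saddleKind`. [folklore] -/
theorem saddleEntry_eq_edgeVal {s : L.EnhancedState} {s' : (L.saddle p q).EnhancedState}
    (hsad : L.IsSaddleMerge p q s.state ∨ L.IsSaddleSplit p q s.state) (hs' : s'.state = s.state) :
    L.saddleEntry p q h t s s' = KhFace.edgeVal R h t (L.saddleKind p q s.state)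
      (L.circleOf s.state) ((L.saddle p q).circleOf s.state) s.label s'.label (L.arcOut p)
      (L.arcOut q) := by
  unfold saddleEntry saddleKind
  rw [if_pos hs']
  by_cases hm : L.IsSaddleMerge p q s.state
  · rw [if_pos hm, if_pos hm]
    rfl
  · rw [if_neg hm, if_neg hm, if_pos (hsad.resolve_left hm)]
    rfl

/-- **The saddle map is homogeneous of homological degree `0`**: a nonzero entry relates enhanced
states of the same homological degree (same state, same `n₋`). Rasmussen (2010), §4.1.
[cite: Rasmussen2010, §4.1] -/
theorem homDegree_eq_of_saddleEntry_ne_zero {s : L.EnhancedState}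
    {s' : (L.saddle p q).EnhancedState} (hs : L.saddleEntry p q h t s s' ≠ 0) :
    homDegree s' = homDegree s := by
  rw [homDegree_saddle, state_eq_of_saddleEntry_ne_zero hs, weight_saddle]
  rfl

end Entry

/-! ## The saddle map on cochains -/

section Linear

variable {R : Type} [CommRing R] (h t : R)

/-- **The saddle map** `S : Cⁱ(L) → Cⁱ(L.saddle p q)` on cochains (coefficient functions on the
enhanced states of homological degree `i`): the matrix of saddle entries (`Matrix.toLin'`,
cast-free, as `khovanovD`). The map induced on the Khovanov complex by the oriented saddle
cobordism between the two link diagrams; Rasmussen (2010), §4.1, eq. (4.1); Khovanov (2000), §6.3;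
Jacobsson (2004). [cite: Rasmussen2010, §4 (4.1)] -/
def saddleMap (i : ℤ) : (L.degStates i → R) →ₗ[R] ((L.saddle p q).degStates i → R) :=
  Matrix.toLin' (Matrix.of fun (s' : (L.saddle p q).degStates i) (s : L.degStates i) ↦
    L.saddleEntry p q h t s.1 s'.1)

/-- The saddle map, evaluated. [folklore] -/
theorem saddleMap_apply (i : ℤ) (f : L.degStates i → R) (s' : (L.saddle p q).degStates i) :
    L.saddleMap p q h t i f s' = ∑ s, L.saddleEntry p q h t s.1 s'.1 * f s := by
  simp only [saddleMap, Matrix.toLin'_apply, Matrix.mulVec, dotProduct, Matrix.of_apply]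

/-- The Khovanov differential of a link diagram, evaluated. [folklore] -/
theorem khovanovD_apply_sum (K : LinkGaussDiagram) (i i' : ℤ) (f : K.degStates i → R)
    (s' : K.degStates i') :
    K.khovanovD R h t i i' f s' = ∑ s, K.incidence R h t s.1 s'.1 * f s := by
  simp only [khovanovD, Matrix.toLin'_apply, Matrix.mulVec, dotProduct, Matrix.of_apply]

/-- A sum over the enhanced states of one homological degree is the sum over all enhanced states
of a function vanishing off that degree. [folklore] -/
theorem sum_degStates_eq_sum_of_vanish {K : LinkGaussDiagram} (k : ℤ) (f : K.EnhancedState → R)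
    (hf : ∀ u, homDegree u ≠ k → f u = 0) : ∑ u : K.degStates k, f u.1 = ∑ u, f u := by
  classical
  rw [← Finset.sum_subtype (Finset.univ.filter fun u : K.EnhancedState ↦ homDegree u = k)
    (by simp) f, Finset.sum_filter]
  refine Finset.sum_congr rfl fun u _ ↦ ?_
  split_ifs with hu
  · rfl
  · exact (hf u hu).symm

end Linear

/-! ## The saddle map is a chain map -/

section ChainMap

variable {L p q} {R : Type} [CommRing R] (h t : R)

/-- **The face "saddle / flip of a chord" commutes** (entrywise form of the chain-map identity):
for enhanced states `s` of `L` and `s''` of `L.saddle p q`,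
`Σ_{s'} S(s; s') ⟨d' s', s''⟩ = Σ_x ⟨d s, x⟩ S(x; s'')`, provided every flip of `L` and of
`L.saddle p q` and the saddle in every state is a merge or a split. Both sides vanish unless
`s''.state = s.state[i ↦ 1]`; then, over the intermediate labellings, the left side is the path
"saddle at `σ`, then flip `i` in `L.saddle p q`" and the right side "flip `i` in `L`, then saddle
at `σ[i ↦ 1]`" of one abstract face of `KhFaces`, with equal Koszul signs (`edgeSign_saddle`):
`KhFace.face_comm` when the over-end of chord `i` is not a head of a saddle arc (the local strands
of `i` are then the same arcs in both diagrams, `arcIn_saddle_of_ne`), and the shared-strand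
variants `face_comm_adj` / `face_comm_adj'` when it is the head of `arcOut p` / `arcOut q` (the
strand `arcIn (overPos i)` is `arcOut p` in `L` but `arcOut q` in `L.saddle p q`, resp.
conversely). Khovanov (2000), §6.3; Jacobsson (2004); Rasmussen (2010), §4.1.
[cite: Khovanov2000, §6] -/
theorem sum_saddleEntry_mul_incidence
    (hms : ∀ (σ : L.State) (k : Fin L.n), σ k = false → L.IsMergeAt σ k ∨ L.IsSplitAt σ k)
    (hms' : ∀ (σ : L.State) (k : Fin L.n), σ k = false →
      (L.saddle p q).IsMergeAt σ k ∨ (L.saddle p q).IsSplitAt σ k)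
    (hsad : ∀ σ : L.State, L.IsSaddleMerge p q σ ∨ L.IsSaddleSplit p q σ)
    (s : L.EnhancedState) (s'' : (L.saddle p q).EnhancedState) :
    ∑ s', L.saddleEntry p q h t s s' * (L.saddle p q).incidence R h t s' s'' =
      ∑ x, L.incidence R h t s x * L.saddleEntry p q h t x s'' := by
  classical
  obtain ⟨σ, la, hla⟩ := s
  obtain ⟨σ'', nu, hnu⟩ := s''
  by_cases hflip : ∃ i, σ i = false ∧ σ'' = Function.update σ i true
  · obtain ⟨i, hi, rfl⟩ := hflip
    -- ### Left-hand side: only `s'` over `σ` contribute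
    have hL1 : ∀ s' : (L.saddle p q).EnhancedState,
        L.saddleEntry p q h t ⟨σ, la, hla⟩ s' * (L.saddle p q).incidence R h t s' ⟨_, nu, hnu⟩ =
        if s'.state = σ then
          L.saddleEntry p q h t ⟨σ, la, hla⟩ s' * (L.saddle p q).incidence R h t s' ⟨_, nu, hnu⟩
        else 0 := by
      intro s'
      split_ifs with hs
      · rfl
      · rw [saddleEntry_of_ne hs, zero_mul]
    have hL2 : ∀ mu : KhFace.Lab ((L.saddle p q).circleOf σ),
        L.saddleEntry p q h t ⟨σ, la, hla⟩ ((L.saddle p q).ofLab σ mu) *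
          (L.saddle p q).incidence R h t ((L.saddle p q).ofLab σ mu) ⟨_, nu, hnu⟩ =
        (edgeSign (L := L) σ i : R) *
          (KhFace.edgeVal R h t (L.saddleKind p q σ) (L.circleOf σ) ((L.saddle p q).circleOf σ)
              la mu.1 (L.arcOut p) (L.arcOut q) *
            KhFace.edgeVal R h t ((L.saddle p q).kindAt σ i) ((L.saddle p q).circleOf σ)
              ((L.saddle p q).circleOf (Function.update σ i true)) mu.1 nu
              ((L.saddle p q).arcIn (L.overPos i)) (L.arcOut (L.overPos i))) := by
      intro mu
      rw [saddleEntry_eq_edgeVal (hsad σ) rfl, incidence_eq_edgeVal h t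
        (s := (L.saddle p q).ofLab σ mu) (x := ⟨_, nu, hnu⟩) (i := i) (hms' σ i hi) rfl]
      dsimp only [ofLab]
      rw [edgeSign_saddle, arcOut_saddle]
      ring
    rw [Finset.sum_congr rfl (fun s' _ ↦ hL1 s'), sum_ite_state_eq (L := L.saddle p q) σ,
      Finset.sum_congr rfl (fun mu _ ↦ hL2 mu), ← Finset.mul_sum]
    -- ### Right-hand side: only `x` over `σ[i ↦ 1]` contribute
    have hR1 : ∀ x : L.EnhancedState,
        L.incidence R h t ⟨σ, la, hla⟩ x * L.saddleEntry p q h t x ⟨_, nu, hnu⟩ =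
        if x.state = Function.update σ i true then
          L.incidence R h t ⟨σ, la, hla⟩ x * L.saddleEntry p q h t x ⟨_, nu, hnu⟩
        else 0 := by
      intro x
      split_ifs with hx
      · rfl
      · rw [saddleEntry_of_ne (fun h' ↦ hx h'.symm), mul_zero]
    have hR2 : ∀ mu : KhFace.Lab (L.circleOf (Function.update σ i true)),
        L.incidence R h t ⟨σ, la, hla⟩ (L.ofLab _ mu) *
          L.saddleEntry p q h t (L.ofLab _ mu) ⟨_, nu, hnu⟩ =
        (edgeSign (L := L) σ i : R) *
          (KhFace.edgeVal R h t (L.kindAt σ i) (L.circleOf σ)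
              (L.circleOf (Function.update σ i true)) la mu.1 (L.arcIn (L.overPos i))
              (L.arcOut (L.overPos i)) *
            KhFace.edgeVal R h t (L.saddleKind p q (Function.update σ i true))
              (L.circleOf (Function.update σ i true))
              ((L.saddle p q).circleOf (Function.update σ i true)) mu.1 nu (L.arcOut p)
              (L.arcOut q)) := by
      intro mu
      rw [incidence_eq_edgeVal h t (s := ⟨σ, la, hla⟩) (x := L.ofLab _ mu) (i := i) (hms σ i hi)
        rfl, saddleEntry_eq_edgeVal (hsad _) rfl]
      dsimp only [ofLab]
      ring
    rw [Finset.sum_congr rfl (fun x _ ↦ hR1 x),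
      sum_ite_state_eq (L := L) (Function.update σ i true),
      Finset.sum_congr rfl (fun mu _ ↦ hR2 mu), ← Finset.mul_sum]
    congr 1
    -- ### The abstract face
    have hlaL : ∀ x y, L.circleOf σ x = L.circleOf σ y → la x = la y := fun x y hxy ↦
      (⟨σ, la, hla⟩ : L.EnhancedState).label_eq_of_circleOf_eq hxy
    have hnuL : ∀ x y, (L.saddle p q).circleOf (Function.update σ i true) x =
        (L.saddle p q).circleOf (Function.update σ i true) y → nu x = nu y := fun x y hxy ↦
      (⟨_, nu, hnu⟩ : (L.saddle p q).EnhancedState).label_eq_of_circleOf_eq hxy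
    have h₁ := edgeOK_saddleKind (hsad σ)
    have h₄ := edgeOK_saddleKind (hsad (Function.update σ i true))
    have h₂ := edgeOK_kindAt (hms' σ i hi) rfl
    have h₃ := edgeOK_kindAt (hms σ i hi) rfl
    change KhFace.EdgeOK _ _ _ ((L.saddle p q).arcIn (L.overPos i)) (L.arcOut (L.overPos i)) at h₂
    by_cases hp : L.overPos i = L.next p
    · -- the over-end of `i` is the head of `arcOut p`
      rw [hp] at h₂ h₃ ⊢
      rw [arcIn_saddle_next_left] at h₂ ⊢
      rw [arcIn_next] at h₃ ⊢
      convert KhFace.face_comm_adj (R := R) (h := h) (t := t) _ _ _ _ h₁ h₂ h₃ h₄ ⟨la, hlaL⟩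
        ⟨nu, hnuL⟩ using 3
    by_cases hq : L.overPos i = L.next q
    · -- the over-end of `i` is the head of `arcOut q`
      rw [hq] at h₂ h₃ ⊢
      rw [arcIn_saddle_next_right] at h₂ ⊢
      rw [arcIn_next] at h₃ ⊢
      convert KhFace.face_comm_adj' (R := R) (h := h) (t := t) _ _ _ _ h₁ h₂ h₃ h₄ ⟨la, hlaL⟩
        ⟨nu, hnuL⟩ using 3
    · -- generic position: the local strands of `i` are the same arcs in both diagrams
      rw [L.arcIn_saddle_of_ne p q hp hq] at h₂ ⊢
      convert KhFace.face_comm (R := R) (h := h) (t := t) _ _ _ _ h₁ h₂ h₃ h₄ ⟨la, hlaL⟩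
        ⟨nu, hnuL⟩ using 3
  · -- ### No flip between the states: both sides vanish termwise
    have hL : ∀ s' : (L.saddle p q).EnhancedState,
        L.saddleEntry p q h t ⟨σ, la, hla⟩ s' *
          (L.saddle p q).incidence R h t s' ⟨σ'', nu, hnu⟩ = 0 := by
      intro s'
      by_cases h1 : L.saddleEntry p q h t ⟨σ, la, hla⟩ s' = 0
      · rw [h1, zero_mul]
      by_cases h2 : (L.saddle p q).incidence R h t s' ⟨σ'', nu, hnu⟩ = 0
      · rw [h2, mul_zero]
      exfalso
      have hst := state_eq_of_saddleEntry_ne_zero h1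
      obtain ⟨i, hi, hx⟩ := exists_of_incidence_ne_zero h2
      simp only at hst hi hx
      rw [hst] at hi hx
      exact hflip ⟨i, hi, hx⟩
    have hR : ∀ x : L.EnhancedState,
        L.incidence R h t ⟨σ, la, hla⟩ x * L.saddleEntry p q h t x ⟨σ'', nu, hnu⟩ = 0 := by
      intro x
      by_cases h1 : L.incidence R h t ⟨σ, la, hla⟩ x = 0
      · rw [h1, zero_mul]
      by_cases h2 : L.saddleEntry p q h t x ⟨σ'', nu, hnu⟩ = 0
      · rw [h2, mul_zero]
      exfalso
      have hst := state_eq_of_saddleEntry_ne_zero h2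
      obtain ⟨i, hi, hx⟩ := exists_of_incidence_ne_zero h1
      simp only at hst hi hx
      rw [← hst] at hx
      exact hflip ⟨i, hi, hx⟩
    rw [Finset.sum_eq_zero (fun s' _ ↦ hL s'), Finset.sum_eq_zero (fun x _ ↦ hR x)]

variable (L p q)

/-- **The saddle map is a chain map**: `d' ∘ S = S ∘ d` between the Khovanov complexes of `L` and
`L.saddle p q` over `A = R[X]/(X² - hX - t)`, in every pair of homological degrees `(i, i')`
(both sides vanish for `i' ≠ i + 1`), provided every edge of the two cubes and the saddle in every
state is a merge or a split (the realisability input, automatic for diagrams of links in `ℝ³` and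
oriented saddles; cf. `khovanovD_comp_khovanovD_of_isMergeAt_or_isSplitAt`). This is the
functoriality of Khovanov's construction under the saddle cobordism: Khovanov (2000), §6.3;
Jacobsson (2004), Thm. 1; Bar-Natan (2005), §8; Rasmussen (2010), §4.1, eq. (4.1).
[cite: Rasmussen2010, §4 (4.1)] -/
theorem khovanovD_comp_saddleMap
    (hms : ∀ (σ : L.State) (k : Fin L.n), σ k = false → L.IsMergeAt σ k ∨ L.IsSplitAt σ k)
    (hms' : ∀ (σ : L.State) (k : Fin L.n), σ k = false →
      (L.saddle p q).IsMergeAt σ k ∨ (L.saddle p q).IsSplitAt σ k)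
    (hsad : ∀ σ : L.State, L.IsSaddleMerge p q σ ∨ L.IsSaddleSplit p q σ) (i i' : ℤ) :
    (L.saddle p q).khovanovD R h t i i' ∘ₗ L.saddleMap p q h t i =
      L.saddleMap p q h t i' ∘ₗ L.khovanovD R h t i i' := by
  refine LinearMap.ext fun f ↦ funext fun s'' ↦ ?_
  simp only [LinearMap.coe_comp, Function.comp_apply, khovanovD_apply_sum, saddleMap_apply]
  -- left-hand side: `Σ_{s'} ⟨d' s', s''⟩ Σ_s S(s; s') f s = Σ_s f s Σ_{s'} S(s; s') ⟨d' s', s''⟩`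
  have hL : ∑ s' : (L.saddle p q).degStates i, (L.saddle p q).incidence R h t s'.1 s''.1 *
      ∑ s : L.degStates i, L.saddleEntry p q h t s.1 s'.1 * f s =
      ∑ s : L.degStates i, f s * ∑ s' : (L.saddle p q).EnhancedState,
        L.saddleEntry p q h t s.1 s' * (L.saddle p q).incidence R h t s' s''.1 := by
    calc _ = ∑ s' : (L.saddle p q).degStates i, ∑ s : L.degStates i, f s *
          (L.saddleEntry p q h t s.1 s'.1 * (L.saddle p q).incidence R h t s'.1 s''.1) := by
          refine Finset.sum_congr rfl fun s' _ ↦ ?_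
          rw [Finset.mul_sum]
          exact Finset.sum_congr rfl fun s _ ↦ by ring
      _ = ∑ s : L.degStates i, ∑ s' : (L.saddle p q).degStates i, f s *
          (L.saddleEntry p q h t s.1 s'.1 * (L.saddle p q).incidence R h t s'.1 s''.1) :=
          Finset.sum_comm
      _ = _ := by
          refine Finset.sum_congr rfl fun s _ ↦ ?_
          rw [← Finset.mul_sum, sum_degStates_eq_sum_of_vanish i (fun s' ↦
            L.saddleEntry p q h t s.1 s' * (L.saddle p q).incidence R h t s' s''.1)]
          intro s' hs'
          by_cases h0 : L.saddleEntry p q h t s.1 s' = 0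
          · rw [h0, zero_mul]
          · exact absurd ((homDegree_eq_of_saddleEntry_ne_zero h0).trans s.2) hs'
  -- right-hand side: `Σ_x S(x; s'') Σ_s ⟨d s, x⟩ f s = Σ_s f s Σ_x ⟨d s, x⟩ S(x; s'')`
  have hR : ∑ x : L.degStates i', L.saddleEntry p q h t x.1 s''.1 *
      ∑ s : L.degStates i, L.incidence R h t s.1 x.1 * f s =
      ∑ s : L.degStates i, f s * ∑ x : L.EnhancedState,
        L.incidence R h t s.1 x * L.saddleEntry p q h t x s''.1 := by
    calc _ = ∑ x : L.degStates i', ∑ s : L.degStates i, f s *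
          (L.incidence R h t s.1 x.1 * L.saddleEntry p q h t x.1 s''.1) := by
          refine Finset.sum_congr rfl fun x _ ↦ ?_
          rw [Finset.mul_sum]
          exact Finset.sum_congr rfl fun s _ ↦ by ring
      _ = ∑ s : L.degStates i, ∑ x : L.degStates i', f s *
          (L.incidence R h t s.1 x.1 * L.saddleEntry p q h t x.1 s''.1) := Finset.sum_comm
      _ = _ := by
          refine Finset.sum_congr rfl fun s _ ↦ ?_
          rw [← Finset.mul_sum, sum_degStates_eq_sum_of_vanish i' (fun x ↦
            L.incidence R h t s.1 x * L.saddleEntry p q h t x s''.1)]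
          intro x hx
          by_cases h0 : L.saddleEntry p q h t x s''.1 = 0
          · rw [h0, mul_zero]
          · exact absurd ((homDegree_eq_of_saddleEntry_ne_zero h0).symm.trans s''.2) hx
  rw [hL, hR]
  exact Finset.sum_congr rfl fun s _ ↦ by rw [sum_saddleEntry_mul_incidence h t hms hms' hsad]

/-- **`S` maps cycles to cycles.** [cite: Rasmussen2010, §4.1] -/
theorem saddleMap_mem_ker
    (hms : ∀ (σ : L.State) (k : Fin L.n), σ k = false → L.IsMergeAt σ k ∨ L.IsSplitAt σ k)
    (hms' : ∀ (σ : L.State) (k : Fin L.n), σ k = false →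
      (L.saddle p q).IsMergeAt σ k ∨ (L.saddle p q).IsSplitAt σ k)
    (hsad : ∀ σ : L.State, L.IsSaddleMerge p q σ ∨ L.IsSaddleSplit p q σ) {i i' : ℤ}
    {x : L.degStates i → R} (hx : x ∈ LinearMap.ker (L.khovanovD R h t i i')) :
    L.saddleMap p q h t i x ∈ LinearMap.ker ((L.saddle p q).khovanovD R h t i i') := by
  rw [LinearMap.mem_ker] at hx ⊢
  have := LinearMap.congr_fun (L.khovanovD_comp_saddleMap p q h t hms hms' hsad i i') x
  simp only [LinearMap.coe_comp, Function.comp_apply] at this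
  rw [this, hx, map_zero]

/-- **`S` maps boundaries to boundaries.** [cite: Rasmussen2010, §4.1] -/
theorem saddleMap_mem_range
    (hms : ∀ (σ : L.State) (k : Fin L.n), σ k = false → L.IsMergeAt σ k ∨ L.IsSplitAt σ k)
    (hms' : ∀ (σ : L.State) (k : Fin L.n), σ k = false →
      (L.saddle p q).IsMergeAt σ k ∨ (L.saddle p q).IsSplitAt σ k)
    (hsad : ∀ σ : L.State, L.IsSaddleMerge p q σ ∨ L.IsSaddleSplit p q σ) {i₀ i : ℤ}
    {x : L.degStates i → R} (hx : x ∈ LinearMap.range (L.khovanovD R h t i₀ i)) :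
    L.saddleMap p q h t i x ∈ LinearMap.range ((L.saddle p q).khovanovD R h t i₀ i) := by
  obtain ⟨w, rfl⟩ := hx
  refine ⟨L.saddleMap p q h t i₀ w, ?_⟩
  have := LinearMap.congr_fun (L.khovanovD_comp_saddleMap p q h t hms hms' hsad i₀ i) w
  simpa only [LinearMap.coe_comp, Function.comp_apply] using this

/-- **The chain map for checkerboard-coloured diagrams.** If `L` carries a checkerboard colouring
`c` of its marked points (`LinkLeeStates.IsCheckerboard`; automatic for diagrams of links in
`ℝ³`) and the band joins arcs of the same colour (`c p = c q`, the combinatorial form of an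
*oriented* saddle, `IsCheckerboard.saddle` of `LinkKhDichotomy`), then every flip of `L` and of
`L.saddle p q` is a merge or a split (`dichotomy_of_isCheckerboard`, `dichotomy_saddle`), so the
only remaining hypothesis of `khovanovD_comp_saddleMap` is that the saddle itself is a merge or a
split in every state. Rasmussen (2010), §4.1, eq. (4.1). [cite: Rasmussen2010, §4 (4.1)] -/
theorem khovanovD_comp_saddleMap_of_isCheckerboard {c : Fin (2 * L.n) → Bool}
    (hc : L.IsCheckerboard c) (hpq : c p = c q)
    (hsad : ∀ σ : L.State, L.IsSaddleMerge p q σ ∨ L.IsSaddleSplit p q σ) (i i' : ℤ) :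
    (L.saddle p q).khovanovD R h t i i' ∘ₗ L.saddleMap p q h t i =
      L.saddleMap p q h t i' ∘ₗ L.khovanovD R h t i i' :=
  L.khovanovD_comp_saddleMap p q h t (L.dichotomy_of_isCheckerboard hc)
    (L.dichotomy_saddle hc hpq) hsad i i'

end ChainMap

/-! ## Degrees: the saddle map is filtered of quantum degree `-1` (Lee's system, `h = 0`) -/

section Degrees

variable {L p q}

/-- The number of state circles of an enhanced state carrying the label `b`: the label part of
the quantum degree is `labelCount s false - labelCount s true`. [folklore] -/
def labelCount {K : LinkGaussDiagram} (s : K.EnhancedState) (b : Bool) : ℕ :=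
  (Finset.univ.filter fun c : K.StateCircle s.state ↦
    ∃ a, K.circleOf s.state a = c ∧ s.label a = b).card

/-- The quantum degree through `labelCount` (definitional unfolding of `qDegree`).
Bar-Natan (2002), §3.2. [cite: BarNatan2002, §3.2] -/
theorem qDegree_eq_labelCount {K : LinkGaussDiagram} (s : K.EnhancedState) :
    qDegree s = (labelCount s false : ℤ) - labelCount s true + s.state.weight + K.nPlus -
      2 * K.nMinus := rfl

/-- **Label count across a saddle-merge**: for labellings `la` of the circles of `L` and `mu` of
those of `L.saddle p q` in the state `σ` agreeing off the merged circle,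
`#S(b) + [mu a = b] = #S'(b) + [la a = b] + [la b' = b]` (`a = arcOut p`, `b' = arcOut q`;
`KhFace.Surg.card_filter_add` for `IsSaddleMerge.surg`). [folklore] -/
theorem IsSaddleMerge.labelCount_add {σ : L.State} (hm : L.IsSaddleMerge p q σ)
    {la : L.Arc → Bool} (hla : ∀ a b, (L.stateGraph σ).Adj a b → la a = la b)
    {mu : L.Arc → Bool} (hmu : ∀ a b, ((L.saddle p q).stateGraph σ).Adj a b → mu a = mu b)
    (hagree : ∀ x, (L.saddle p q).circleOf σ x ≠ (L.saddle p q).circleOf σ (L.arcOut p) →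
      mu x = la x) (b : Bool) :
    labelCount (⟨σ, la, hla⟩ : L.EnhancedState) b + (if mu (L.arcOut p) = b then 1 else 0) =
      labelCount (⟨σ, mu, hmu⟩ : (L.saddle p q).EnhancedState) b +
        (if la (L.arcOut p) = b then 1 else 0) + (if la (L.arcOut q) = b then 1 else 0) := by
  have hlaL : ∀ x y, L.circleOf σ x = L.circleOf σ y → la x = la y := fun x y hxy ↦
    (⟨σ, la, hla⟩ : L.EnhancedState).label_eq_of_circleOf_eq hxy
  have hmuL : ∀ x y, (L.saddle p q).circleOf σ x = (L.saddle p q).circleOf σ y → mu x = mu y :=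
    fun x y hxy ↦ (⟨σ, mu, hmu⟩ : (L.saddle p q).EnhancedState).label_eq_of_circleOf_eq hxy
  exact hm.surg.card_filter_add (L.circleOf_surjective σ) ((L.saddle p q).circleOf_surjective σ)
    hlaL hmuL hagree b

/-- **Label count across a saddle-split** (the same identity read from `IsSaddleSplit.surg`: the
labels `mu` after the split agree with `la` off the split circle). [folklore] -/
theorem IsSaddleSplit.labelCount_add {σ : L.State} (hsp : L.IsSaddleSplit p q σ)
    {la : L.Arc → Bool} (hla : ∀ a b, (L.stateGraph σ).Adj a b → la a = la b)
    {mu : L.Arc → Bool} (hmu : ∀ a b, ((L.saddle p q).stateGraph σ).Adj a b → mu a = mu b)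
    (hagree : ∀ x, L.circleOf σ x ≠ L.circleOf σ (L.arcOut p) → mu x = la x) (b : Bool) :
    labelCount (⟨σ, mu, hmu⟩ : (L.saddle p q).EnhancedState) b +
        (if la (L.arcOut p) = b then 1 else 0) =
      labelCount (⟨σ, la, hla⟩ : L.EnhancedState) b + (if mu (L.arcOut p) = b then 1 else 0) +
        (if mu (L.arcOut q) = b then 1 else 0) := by
  have hlaL : ∀ x y, L.circleOf σ x = L.circleOf σ y → la x = la y := fun x y hxy ↦
    (⟨σ, la, hla⟩ : L.EnhancedState).label_eq_of_circleOf_eq hxy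
  have hmuL : ∀ x y, (L.saddle p q).circleOf σ x = (L.saddle p q).circleOf σ y → mu x = mu y :=
    fun x y hxy ↦ (⟨σ, mu, hmu⟩ : (L.saddle p q).EnhancedState).label_eq_of_circleOf_eq hxy
  exact hsp.surg.card_filter_add ((L.saddle p q).circleOf_surjective σ)
    (L.circleOf_surjective σ) hmuL hlaL (fun x hx ↦ (hagree x hx).symm) b

/-- **The saddle map is filtered of quantum degree `-1`** (Lee's system `h = 0`, any `t`): a
nonzero entry `S(s; s')` has `qDegree s' ≥ qDegree s - 1`. The weight, `n₊`, `n₋` are unchanged;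
in the merge case the two circles of the saddle arcs (labels `x₁`, `x₂`) become one (label `z`)
and all other circles keep their labels, so the label part changes by
`deg z - deg x₁ - deg x₂ ∈ {-1, 3}` (`labelDeg_sub_ge_of_mergeCoeff_ne_zero`); in the split case
by `deg v + deg w - deg z ∈ {-1, 3}` (`labelDeg_add_sub_ge_of_splitCoeff_ne_zero`); the circle
bookkeeping is `KhFace.Surg.card_filter_add` for `IsSaddleMerge.surg` / `IsSaddleSplit.surg`.
This is `χ = -1` for the saddle: Rasmussen (2010), §4.1–4.2 (the map of an elementary cobordism of
Euler characteristic `χ` is filtered of degree `χ`). [cite: Rasmussen2010, §4.1] -/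
theorem qDegree_ge_of_saddleEntry_ne_zero {R : Type} [CommRing R] (t : R) {s : L.EnhancedState}
    {s' : (L.saddle p q).EnhancedState} (h0 : L.saddleEntry p q 0 t s s' ≠ 0) :
    qDegree s - 1 ≤ qDegree s' := by
  obtain ⟨σ, la, hla⟩ := s
  obtain ⟨σ', mu, hmu⟩ := s'
  have hst := state_eq_of_saddleEntry_ne_zero h0
  simp only at hst
  subst σ'
  unfold saddleEntry at h0
  simp only [if_true] at h0
  rw [qDegree_eq_labelCount, qDegree_eq_labelCount]
  simp only [nPlus_saddle, nMinus_saddle, weight_saddle]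
  split_ifs at h0 with hm hsp
  · -- merge
    unfold KhFace.mergeInc at h0
    split_ifs at h0 with hagree
    · have hF := hm.labelCount_add hla hmu hagree false
      have hT := hm.labelCount_add hla hmu hagree true
      have hd := GaussDiagram.labelDeg_sub_ge_of_mergeCoeff_ne_zero h0
      cases h1 : la (L.arcOut p) <;> cases h2 : la (L.arcOut q) <;> cases h3 : mu (L.arcOut p) <;>
        simp only [h1, h2, h3, if_true, if_false, Bool.false_eq_true, Bool.true_eq_false,
          GaussDiagram.labelDeg] at hF hT hd ⊢ <;> omega
    · exact (h0 rfl).elim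
  · -- split
    unfold KhFace.splitInc at h0
    split_ifs at h0 with hagree
    · have hF := hsp.labelCount_add hla hmu hagree false
      have hT := hsp.labelCount_add hla hmu hagree true
      have hd := GaussDiagram.labelDeg_add_sub_ge_of_splitCoeff_ne_zero h0
      cases h1 : la (L.arcOut p) <;> cases h2 : mu (L.arcOut p) <;> cases h3 : mu (L.arcOut q) <;>
        simp only [h1, h2, h3, if_true, if_false, Bool.false_eq_true, Bool.true_eq_false,
          GaussDiagram.labelDeg] at hF hT hd ⊢ <;> omega
    · exact (h0 rfl).elim
  · exact (h0 rfl).elim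

/-- At `h = t = 0` **the saddle map is homogeneous of quantum degree `-1`**: a nonzero entry has
`qDegree s' = qDegree s - 1` (`1·1 = 1`, `1·X = X`, `X·X = 0`; `Δ1 = 1⊗X + X⊗1`, `ΔX = X⊗X`),
over any commutative ring without zero divisors (e.g. `ℤ`, `ℚ`). Khovanov (2000), §6.3;
Jacobsson (2004). [cite: Khovanov2000, §6] -/
theorem qDegree_eq_of_saddleEntry_ne_zero {R : Type} [CommRing R] [NoZeroDivisors R]
    {s : L.EnhancedState} {s' : (L.saddle p q).EnhancedState}
    (h0 : L.saddleEntry p q (0 : R) 0 s s' ≠ 0) : qDegree s' = qDegree s - 1 := by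
  obtain ⟨σ, la, hla⟩ := s
  obtain ⟨σ', mu, hmu⟩ := s'
  have hst := state_eq_of_saddleEntry_ne_zero h0
  simp only at hst
  subst σ'
  unfold saddleEntry at h0
  simp only [if_true] at h0
  rw [qDegree_eq_labelCount, qDegree_eq_labelCount]
  simp only [nPlus_saddle, nMinus_saddle, weight_saddle]
  split_ifs at h0 with hm hsp
  · unfold KhFace.mergeInc at h0
    split_ifs at h0 with hagree
    · have hF := hm.labelCount_add hla hmu hagree false
      have hT := hm.labelCount_add hla hmu hagree true
      cases h1 : la (L.arcOut p) <;> cases h2 : la (L.arcOut q) <;> cases h3 : mu (L.arcOut p) <;>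
        simp only [h1, h2, h3, if_true, if_false, Bool.false_eq_true, Bool.true_eq_false,
          GaussDiagram.mergeCoeff, ne_eq, not_true_eq_false] at hF hT h0 ⊢ <;> omega
    · exact (h0 rfl).elim
  · unfold KhFace.splitInc at h0
    split_ifs at h0 with hagree
    · have hF := hsp.labelCount_add hla hmu hagree false
      have hT := hsp.labelCount_add hla hmu hagree true
      cases h1 : la (L.arcOut p) <;> cases h2 : mu (L.arcOut p) <;> cases h3 : mu (L.arcOut q) <;>
        simp only [h1, h2, h3, if_true, if_false, Bool.false_eq_true, Bool.true_eq_false,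
          GaussDiagram.splitCoeff, ne_eq, not_true_eq_false, neg_zero] at hF hT h0 ⊢ <;> omega
    · exact (h0 rfl).elim
  · exact (h0 rfl).elim

variable (L p q)

/-- **Filtration.** If `m ≤ q(x)` for the filtration degree of a degree-zero chain `x` of `L`
(Lee's theory over `ℚ`, `h = 0`), then `m - 1 ≤ q(S x)`: the saddle map is filtered of degree
`-1` (the shape of `le_qMin_mergeMap` / `le_qMin_splitMap_apply` of the knot tower).
Rasmussen (2010), §4.1–4.2. [cite: Rasmussen2010, §4.1] -/
theorem le_qMin_saddleMap (t : ℚ) (x : L.degStates 0 → ℚ) {m : ℤ}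
    (hm : ((m : WithTop ℤ) : WithBot (WithTop ℤ)) ≤ qMin x) :
    (((m - 1 : ℤ) : WithTop ℤ) : WithBot (WithTop ℤ)) ≤ qMin (L.saddleMap p q 0 t 0 x) := by
  rw [coe_le_qMin_iff_qDegree] at hm ⊢
  intro s' hs'
  rw [saddleMap_apply] at hs'
  obtain ⟨s, -, hs⟩ := Finset.exists_ne_zero_of_sum_ne_zero hs'
  have hx : x s ≠ 0 := fun h0 ↦ hs (by rw [h0, mul_zero])
  have he : L.saddleEntry p q 0 t s.1 s'.1 ≠ 0 := fun h0 ↦ hs (by rw [h0, zero_mul])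
  have := qDegree_ge_of_saddleEntry_ne_zero t he
  have := hm s hx
  linarith

/-- **Filtration, pointwise**: if `m ≤ q(x)`, every enhanced state in the support of `S x` has
quantum degree at least `m - 1` (pointwise form of `le_qMin_saddleMap`). Rasmussen (2010), §4.1.
[cite: Rasmussen2010, §4.1] -/
theorem qDegree_ge_of_saddleMap_ne_zero (t : ℚ) (x : L.degStates 0 → ℚ) {m : ℤ}
    (hm : ((m : WithTop ℤ) : WithBot (WithTop ℤ)) ≤ qMin x) (s' : (L.saddle p q).degStates 0)
    (hs' : L.saddleMap p q 0 t 0 x s' ≠ 0) : m - 1 ≤ qDegree s'.1 :=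
  (coe_le_qMin_iff_qDegree.1 (L.le_qMin_saddleMap p q t x hm)) s' hs'

end Degrees

/-! ## Lee's theory: degree-zero cycles and boundaries -/

section Lee

/-- **The Lee saddle map on degree-zero cycles**: for Lee's system `(ℚ, h, t) = (ℚ, 0, 1)` the
saddle map carries `leeCycles L = ker d₀` into `leeCycles (L.saddle p q)` (chain map,
`saddleMap_mem_ker`), under the merge-or-split hypotheses. Rasmussen (2010), §4.1.
[cite: Rasmussen2010, §4.1] -/
theorem saddleMap_mem_leeCycles
    (hms : ∀ (σ : L.State) (k : Fin L.n), σ k = false → L.IsMergeAt σ k ∨ L.IsSplitAt σ k)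
    (hms' : ∀ (σ : L.State) (k : Fin L.n), σ k = false →
      (L.saddle p q).IsMergeAt σ k ∨ (L.saddle p q).IsSplitAt σ k)
    (hsad : ∀ σ : L.State, L.IsSaddleMerge p q σ ∨ L.IsSaddleSplit p q σ)
    {z : L.degStates 0 → ℚ} (hz : z ∈ L.leeCycles) :
    L.saddleMap p q 0 1 0 z ∈ (L.saddle p q).leeCycles :=
  L.saddleMap_mem_ker p q 0 1 hms hms' hsad hz

/-- **The Lee saddle map on degree-zero boundaries**: it carries `range d₋₁` of `L` into
`range d₋₁` of `L.saddle p q`, hence descends to Lee homology `Kh'⁰`. Rasmussen (2010), §4.1.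
[cite: Rasmussen2010, §4.1] -/
theorem saddleMap_mem_range_leeD
    (hms : ∀ (σ : L.State) (k : Fin L.n), σ k = false → L.IsMergeAt σ k ∨ L.IsSplitAt σ k)
    (hms' : ∀ (σ : L.State) (k : Fin L.n), σ k = false →
      (L.saddle p q).IsMergeAt σ k ∨ (L.saddle p q).IsSplitAt σ k)
    (hsad : ∀ σ : L.State, L.IsSaddleMerge p q σ ∨ L.IsSaddleSplit p q σ)
    {x : L.degStates 0 → ℚ} (hx : x ∈ LinearMap.range (L.leeD (0 - 1) 0)) :
    L.saddleMap p q 0 1 0 x ∈ LinearMap.range ((L.saddle p q).leeD (0 - 1) 0) :=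
  L.saddleMap_mem_range p q 0 1 hms hms' hsad hx

/-- **The Lee saddle map on degree-zero Lee homology** `Kh'⁰(L) → Kh'⁰(L.saddle p q)`: the map of
quotients induced by the saddle map on cycles (`saddleMap_mem_leeCycles`), well defined by
`saddleMap_mem_range_leeD`. Rasmussen (2010), §4.1 (the map `φ_S` of a saddle cobordism on Lee
homology). [cite: Rasmussen2010, §4.1] -/
def leeHomologyZeroMap
    (hms : ∀ (σ : L.State) (k : Fin L.n), σ k = false → L.IsMergeAt σ k ∨ L.IsSplitAt σ k)
    (hms' : ∀ (σ : L.State) (k : Fin L.n), σ k = false →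
      (L.saddle p q).IsMergeAt σ k ∨ (L.saddle p q).IsSplitAt σ k)
    (hsad : ∀ σ : L.State, L.IsSaddleMerge p q σ ∨ L.IsSaddleSplit p q σ) :
    L.LeeHomologyZero →ₗ[ℚ] (L.saddle p q).LeeHomologyZero :=
  Submodule.mapQ _ _ ((L.saddleMap p q 0 1 0).restrict fun z hz ↦
      L.saddleMap_mem_leeCycles p q hms hms' hsad hz) (by
    rintro ⟨z, hz⟩ hzr
    rw [Submodule.mem_comap] at hzr ⊢
    exact L.saddleMap_mem_range_leeD p q hms hms' hsad hzr)

/-- The Lee homology map of a saddle on the class of a cycle is the class of its image.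
[folklore] -/
theorem leeHomologyZeroMap_mk
    (hms : ∀ (σ : L.State) (k : Fin L.n), σ k = false → L.IsMergeAt σ k ∨ L.IsSplitAt σ k)
    (hms' : ∀ (σ : L.State) (k : Fin L.n), σ k = false →
      (L.saddle p q).IsMergeAt σ k ∨ (L.saddle p q).IsSplitAt σ k)
    (hsad : ∀ σ : L.State, L.IsSaddleMerge p q σ ∨ L.IsSaddleSplit p q σ) (z : L.leeCycles) :
    L.leeHomologyZeroMap p q hms hms' hsad (Submodule.Quotient.mk z) =
      Submodule.Quotient.mk
        ⟨L.saddleMap p q 0 1 0 z, L.saddleMap_mem_leeCycles p q hms hms' hsad z.2⟩ :=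
  rfl

end Lee

/-! ## Bookkeeping: the inverse saddle -/

section Inverse

/-- Read backwards the saddle is the same band: the state graphs of `(L.saddle p q).saddle p q`
are those of `L` (`saddle_saddle`; stated for the graphs to avoid transporting along the equality
of diagrams). [folklore] -/
theorem stateGraph_saddle_saddle (σ : L.State) :
    ((L.saddle p q).saddle p q).stateGraph σ = L.stateGraph σ := by
  have harc : ∀ r, ((L.saddle p q).saddle p q).arcIn r = L.arcIn r := fun r ↦ by
    show Sum.inl ((L.next * Equiv.swap p q * Equiv.swap p q).symm r) = Sum.inl (L.next.symm r)
    rw [mul_assoc, Equiv.swap_mul_self, mul_one]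
  ext u v
  simp only [stateGraph, SimpleGraph.fromRel_adj, stateAdj, harc]
  rfl

/-- The inverse saddle is a split in `σ` iff the original one is a merge in `σ`.
Rasmussen (2010), §4.1. [cite: Rasmussen2010, §4.1] -/
theorem isSaddleSplit_saddle_iff (σ : L.State) :
    (L.saddle p q).IsSaddleSplit p q σ ↔ L.IsSaddleMerge p q σ := by
  unfold IsSaddleSplit IsSaddleMerge
  rw [Ne, Ne, circleOf_eq_iff_reachable, circleOf_eq_iff_reachable, stateGraph_saddle_saddle]
  rfl

/-- Hence the inverse saddle is a merge or a split in every state iff the original one is.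
[folklore] -/
theorem saddle_merge_or_split_iff :
    (∀ σ : L.State, (L.saddle p q).IsSaddleMerge p q σ ∨ (L.saddle p q).IsSaddleSplit p q σ) ↔
      ∀ σ : L.State, L.IsSaddleMerge p q σ ∨ L.IsSaddleSplit p q σ :=
  forall_congr' fun σ ↦ by rw [isSaddleMerge_saddle_iff, isSaddleSplit_saddle_iff, or_comm]

end Inverse

/-! ## Sanity: bands on the Hopf link -/

section Sanity

/-- The marked point `1` of the Hopf link diagram `hopfLink` (on component `A`, the under-passage
of chord `1`): the arc leaving it is the outer arc of `A`. [folklore] -/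
def hopfPt1 : Fin (2 * hopfLink.n) := ⟨1, by decide⟩

/-- The marked point `2` of `hopfLink` (on component `B`, the under-passage of chord `0`): the arc
leaving it is the clasp arc of `B`, anti-parallel to the outer arc of `A` across the region they
bound. [folklore] -/
def hopfPt2 : Fin (2 * hopfLink.n) := ⟨2, by decide⟩

/-- The marked point `0` of `hopfLink` (on `A`): the arc leaving it is the clasp arc of `A`,
parallel to the clasp arc of `B` across the clasp region. [folklore] -/
def hopfPt0 : Fin (2 * hopfLink.n) := ⟨0, by decide⟩

/-- **Sanity (an oriented band).** The saddle of the Hopf link along the arcs leaving `1` and `2`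
(an orientable planar band across the region bounded by the outer arc of `A` and the clasp arc of
`B`) is a merge or a split in EVERY state: the hypothesis `hsad` of `khovanovD_comp_saddleMap`
holds (`decide`). Rasmussen (2010), §4.1. [cite: Rasmussen2010, §4.1] -/
theorem hopfLink_band_merge_or_split (σ : hopfLink.State) :
    hopfLink.IsSaddleMerge hopfPt1 hopfPt2 σ ∨ hopfLink.IsSaddleSplit hopfPt1 hopfPt2 σ := by
  revert σ
  unfold IsSaddleMerge IsSaddleSplit
  set_option maxRecDepth 16000 in decide

/-- In the oriented resolution this band is a split (both arcs lie on one Seifert circle).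
[folklore] -/
theorem hopfLink_band_isSaddleSplit : hopfLink.IsSaddleSplit hopfPt1 hopfPt2 fun _ ↦ false := by
  unfold IsSaddleSplit
  set_option maxRecDepth 16000 in decide

/-- **Sanity (a non-orientable band is excluded).** The saddle of `hopfLink` along the two clasp
arcs (leaving `0` and `2`; they are parallel, so a planar band between them is not orientable and
the oriented reconnection `saddle 0 2` is virtual) is NEITHER a merge nor a split in the all-`1`
state: a one-to-one bifurcation, showing that the hypothesis `hsad` is a genuine restriction.
Viro (2004), §5. [cite: Viro2004, §5] -/
theorem hopfLink_clasp_not_merge_or_split :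
    ¬ (hopfLink.IsSaddleMerge hopfPt0 hopfPt2 (fun _ ↦ true) ∨
      hopfLink.IsSaddleSplit hopfPt0 hopfPt2 (fun _ ↦ true)) := by
  unfold IsSaddleMerge IsSaddleSplit
  set_option maxRecDepth 16000 in decide

/-- **Sanity (an unconditional chain map).** For the oriented band on the Hopf link all three
hypotheses of `khovanovD_comp_saddleMap` hold — the flips by the checkerboard colouring
`isCheckerboard_hopfLink` of D2c (`![true, false, false, true]`, equal at `1` and `2`), the saddle
by `hopfLink_band_merge_or_split` — so its saddle map is a chain map over every
`A = R[X]/(X² - hX - t)`, unconditionally. Rasmussen (2010), §4.1, eq. (4.1).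
[cite: Rasmussen2010, §4 (4.1)] -/
theorem khovanovD_comp_saddleMap_hopfLink {R : Type} [CommRing R] (h t : R) (i i' : ℤ) :
    (hopfLink.saddle hopfPt1 hopfPt2).khovanovD R h t i i' ∘ₗ
        hopfLink.saddleMap hopfPt1 hopfPt2 h t i =
      hopfLink.saddleMap hopfPt1 hopfPt2 h t i' ∘ₗ hopfLink.khovanovD R h t i i' :=
  hopfLink.khovanovD_comp_saddleMap_of_isCheckerboard hopfPt1 hopfPt2 h t isCheckerboard_hopfLink
    rfl hopfLink_band_merge_or_split i i'

end Sanity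

end LinkGaussDiagram

end Literature.Topology.FourManifolds
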